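import Summits.ABC.ABC.Theorems.CuspFieldPencilGoldenCuspShadow
import Summits.ABC.ABC.Theorems.CuspFieldPencilNFPencilOfScoones
import HarnessLib

/-!
# STUB-IDEAS `stub_conjugateCuspTriple` — ideator k=2, GEN 8 (FAMILY 2: RESHAPE) — Sketch (SORRY-FREE)

`lean check --json`: rc 0, 0 errors, 0 warnings, **0 sorries**; every theorem below depends only on
`[propext, Classical.choice, Quot.sound]` (checked with `#print axioms`).

Crux `GoldenCuspShadow` (stmt-ABC-26026) is PROVED in the tree
(`Summit.ABC.ABC.Theorems.goldenCuspShadow_proof`, file `CuspFieldPencilGoldenCuspShadow.lean`), together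
with the min-form `GoldenCuspShadowBaker.cuspMinRadBound_holds : log H ≤ κ_ε R^ε · min(rad u, rad w)`.
Notation: `Q = u² − 11uw − w²`, `R = rad(uwQ)`, `H = max(|u|,|w|)`, `q = rad Q`, `m = min(rad u, rad w)`.

RESHAPE (gen 8): the verbatim stub `Sig` (`log H ≤ κ_ε R^ε · q^{2/3} m^{2/3}`) is re-hung from the route's
OWN parametric item `NFPencilBound` (stmt-ABC-26250): `sig_of_nfPencilBound : NFPencilBound → Sig` is the
`k = 3` golden instance run on the conjugate-cusp sub-pencil `(w, x₊, x₋)` plus the cusp swap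
`(u, w) ↦ (w, −u)` — an UNCONDITIONAL implication between route items, parallel to the landed
`goldenFromNFPencil_proof : NFPencilBound → GoldenCuspShadow` (`k = 4`), whose conjugate-pair norm
bookkeeping (`G₊G₋ ≤ N(5√5)·q²`) it re-uses verbatim.  Consequences proved here:
* `stub_conjugateCuspTriple_of_scoones2021 : scoones2021_abcNumberField_classNumberOne → Sig`
  — the registered stub PROVED-MOD-FACT {Scoones 2023, Thm 3} (via landed `nfPencilBound_of_scoones2021`);
* `sig_of_qSideRadSq : QSideRadSq → Sig` — the k3 road's target (`log H ≤ κ_ε R^ε q²`) already suffices,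
  by the regime split `min(m, q²) ≤ q^{2/3} m^{2/3}` against the landed `cuspMin`;
* payoffs: `goldenTwoFifths_of_sig : CuspMin → Sig → (log H ≤ κ_ε R^{2/5+ε})` hence
  `goldenTwoFifths_of_scoones2021`; `goldenThird_of_qSideRad : CuspMin → QSideRad → (log H ≤ κ_ε R^{1/3+ε})`.
NOT abc, NOT A-PS; abc moved by 0 (all statements are about the one binary form `uw(u²−11uw−w²)`).
-/

set_option linter.dupNamespace false

noncomputable section

open Real NumberField UniqueFactorizationMonoid QuadraticAlgebra
open Literature.NumberTheory.DiophantineGeometry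

namespace Summit.ABC.ABC.Cruxes.GoldenCuspShadow.SideaK2G8

/-! ## §0 Statements (all expanded; no local notation) -/

/-- The registered stub `stub_conjugateCuspTriple` (VERBATIM signature). -/
def Sig : Prop :=
  ∀ ε : ℝ, 0 < ε → ∃ κ : ℝ, ∀ u w : ℤ, IsCoprime u w → u * w * (u ^ 2 - 11 * u * w - w ^ 2) ≠ 0 → Real.log (max (|(u : ℝ)|) (|(w : ℝ)|)) ≤ κ * (((UniqueFactorizationMonoid.radical (u * w * (u ^ 2 - 11 * u * w - w ^ 2))).natAbs : ℕ) : ℝ) ^ (ε : ℝ) * ((((UniqueFactorizationMonoid.radical (u ^ 2 - 11 * u * w - w ^ 2)).natAbs : ℕ) : ℝ) ^ (2 / 3 : ℝ) * (min (((UniqueFactorizationMonoid.radical u).natAbs : ℕ) : ℝ) (((UniqueFactorizationMonoid.radical w).natAbs : ℕ) : ℝ)) ^ (2 / 3 : ℝ))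

/-- `SideW`: the `(w, x₊, x₋)` conjugate triple: `log H ≤ κ_ε R^ε · q^{2/3} · (rad w)^{2/3}`. -/
def SideW : Prop :=
  ∀ ε : ℝ, 0 < ε → ∃ κ : ℝ, ∀ u w : ℤ, IsCoprime u w → u * w * (u ^ 2 - 11 * u * w - w ^ 2) ≠ 0 →
    Real.log (max (|(u : ℝ)|) (|(w : ℝ)|)) ≤
      κ * (((radical (u * w * (u ^ 2 - 11 * u * w - w ^ 2))).natAbs : ℕ) : ℝ) ^ (ε : ℝ) *
        ((((radical (u ^ 2 - 11 * u * w - w ^ 2)).natAbs : ℕ) : ℝ) ^ (2 / 3 : ℝ) *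
          (((radical w).natAbs : ℕ) : ℝ) ^ (2 / 3 : ℝ))

/-- `SideU`: the `(u, x₊, x₋)` conjugate triple: `log H ≤ κ_ε R^ε · q^{2/3} · (rad u)^{2/3}`. -/
def SideU : Prop :=
  ∀ ε : ℝ, 0 < ε → ∃ κ : ℝ, ∀ u w : ℤ, IsCoprime u w → u * w * (u ^ 2 - 11 * u * w - w ^ 2) ≠ 0 →
    Real.log (max (|(u : ℝ)|) (|(w : ℝ)|)) ≤
      κ * (((radical (u * w * (u ^ 2 - 11 * u * w - w ^ 2))).natAbs : ℕ) : ℝ) ^ (ε : ℝ) *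
        ((((radical (u ^ 2 - 11 * u * w - w ^ 2)).natAbs : ℕ) : ℝ) ^ (2 / 3 : ℝ) *
          (((radical u).natAbs : ℕ) : ℝ) ^ (2 / 3 : ℝ))

/-- `CuspMin` (the LANDED min-form, shape of `GoldenCuspShadowBaker.cuspMinRadBound_holds`). -/
def CuspMin : Prop :=
  ∀ ε : ℝ, 0 < ε → ∃ κ : ℝ, ∀ u w : ℤ, IsCoprime u w → u * w * (u ^ 2 - 11 * u * w - w ^ 2) ≠ 0 →
    Real.log (max (|(u : ℝ)|) (|(w : ℝ)|)) ≤
      κ * (((radical (u * w * (u ^ 2 - 11 * u * w - w ^ 2))).natAbs : ℕ) : ℝ) ^ (ε : ℝ) *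
        min ((((radical u).natAbs : ℕ) : ℝ)) ((((radical w).natAbs : ℕ) : ℝ))

/-- `QSideRadSq`: the crude `K`-datum `log H ≤ κ_ε R^ε · q²` (k3 road). -/
def QSideRadSq : Prop :=
  ∀ ε : ℝ, 0 < ε → ∃ κ : ℝ, ∀ u w : ℤ, IsCoprime u w → u * w * (u ^ 2 - 11 * u * w - w ^ 2) ≠ 0 →
    Real.log (max (|(u : ℝ)|) (|(w : ℝ)|)) ≤
      κ * (((radical (u * w * (u ^ 2 - 11 * u * w - w ^ 2))).natAbs : ℕ) : ℝ) ^ (ε : ℝ) *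
        (((radical (u ^ 2 - 11 * u * w - w ^ 2)).natAbs : ℕ) : ℝ) ^ 2

/-- `QSideRad`: the fine `K`-datum `log H ≤ κ_ε R^ε · q` (k2-g7 road). -/
def QSideRad : Prop :=
  ∀ ε : ℝ, 0 < ε → ∃ κ : ℝ, ∀ u w : ℤ, IsCoprime u w → u * w * (u ^ 2 - 11 * u * w - w ^ 2) ≠ 0 →
    Real.log (max (|(u : ℝ)|) (|(w : ℝ)|)) ≤
      κ * (((radical (u * w * (u ^ 2 - 11 * u * w - w ^ 2))).natAbs : ℕ) : ℝ) ^ (ε : ℝ) *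
        (((radical (u ^ 2 - 11 * u * w - w ^ 2)).natAbs : ℕ) : ℝ)

/-- Class exponent `2/5` on the 5-torsion cusp form: `log H ≤ κ_ε R^{2/5+ε}`. -/
def GoldenTwoFifths : Prop :=
  ∀ ε : ℝ, 0 < ε → ∃ κ : ℝ, ∀ u w : ℤ, IsCoprime u w → u * w * (u ^ 2 - 11 * u * w - w ^ 2) ≠ 0 →
    Real.log (max (|(u : ℝ)|) (|(w : ℝ)|)) ≤
      κ * (((radical (u * w * (u ^ 2 - 11 * u * w - w ^ 2))).natAbs : ℕ) : ℝ) ^ (2 / 5 + ε : ℝ)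

/-- Class exponent `1/3`: `log H ≤ κ_ε R^{1/3+ε}`. -/
def GoldenThird : Prop :=
  ∀ ε : ℝ, 0 < ε → ∃ κ : ℝ, ∀ u w : ℤ, IsCoprime u w → u * w * (u ^ 2 - 11 * u * w - w ^ 2) ≠ 0 →
    Real.log (max (|(u : ℝ)|) (|(w : ℝ)|)) ≤
      κ * (((radical (u * w * (u ^ 2 - 11 * u * w - w ^ 2))).natAbs : ℕ) : ℝ) ^ (1 / 3 + ε : ℝ)

/-! ## §1 ROAD R1 — `NFPencilBound → Sig` (golden instance `k = 3` on `(w, x₊, x₋)`, then the cusp swap) -/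

/-- **L1′ [XS]** product of the three forms of the `w`-sub-pencil: `w · x₊ · x₋ = w·Q`
(`Fin.prod_univ_three`, `simp`, `linear_combination (-(25:S) * w ^ 3) * hθ`). -/
theorem prod_forms_three {S : Type*} [CommRing S] (θ u w β₂ β₃ : S) (h₂ : β₂ = -3 - 5 * θ)
    (h₃ : β₃ = -8 + 5 * θ) (hθ : θ * θ = θ + 1) :
    ∏ i : Fin 3, ((![0, 1, 1] : Fin 3 → S) i * u + (![1, β₂, β₃] : Fin 3 → S) i * w) =
      w * (u ^ 2 - 11 * u * w - w ^ 2) := by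
  subst h₂ h₃
  simp only [Fin.prod_univ_three, Matrix.cons_val_zero, Matrix.cons_val_one, Matrix.head_cons,
    Matrix.cons_val_two, Matrix.tail_cons]
  linear_combination (-(25 : S) * w ^ 3) * hθ

/-- **L2 [S]** real step: `L ≤ C·P^{1/3+ε/2}`, `P ≤ C₀·X²`, `X ≤ R` ⇒
`L ≤ (max C 0 · C₀^{1/3+ε/2}) · R^ε · X^{2/3}` (pattern: landed `GoldenFromNFPencil.real_step`;
`Real.mul_rpow`, `Real.rpow_natCast`, `← Real.rpow_mul`, `Real.rpow_le_rpow_left_iff`/`rpow_le_rpow`). -/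
theorem real_step_twoThirds {L C ε : ℝ} {P C₀ X R : ℕ} (hε : 0 < ε)
    (hL : L ≤ C * (P : ℝ) ^ (1 / (3 : ℝ) + ε / 2)) (hP : P ≤ C₀ * X ^ 2) (hXR : X ≤ R) :
    L ≤ (max C 0 * (C₀ : ℝ) ^ (1 / (3 : ℝ) + ε / 2)) * (R : ℝ) ^ (ε : ℝ) * (X : ℝ) ^ (2 / 3 : ℝ) := by
  set e : ℝ := 1 / (3 : ℝ) + ε / 2 with he
  have he0 : 0 ≤ e := by rw [he]; positivity
  have hX0 : (0 : ℝ) ≤ X := Nat.cast_nonneg _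
  have hPR : (P : ℝ) ≤ (C₀ : ℝ) * (X : ℝ) ^ 2 := by exact_mod_cast hP
  have hPe : (P : ℝ) ^ e ≤ ((C₀ : ℝ) * (X : ℝ) ^ 2) ^ e :=
    Real.rpow_le_rpow (Nat.cast_nonneg _) hPR he0
  have hsplit : ((C₀ : ℝ) * (X : ℝ) ^ 2) ^ e =
      (C₀ : ℝ) ^ e * ((X : ℝ) ^ (2 / 3 : ℝ) * (X : ℝ) ^ (ε : ℝ)) := by
    rw [Real.mul_rpow (Nat.cast_nonneg _) (pow_nonneg (Nat.cast_nonneg _) 2)]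
    congr 1
    rw [show ((X : ℝ) ^ 2) = (X : ℝ) ^ (2 : ℝ) by norm_cast, ← Real.rpow_mul hX0,
      ← Real.rpow_add' hX0 (by positivity)]
    congr 1
    rw [he]; ring
  have hXε : (X : ℝ) ^ (ε : ℝ) ≤ (R : ℝ) ^ (ε : ℝ) :=
    Real.rpow_le_rpow hX0 (by exact_mod_cast hXR) hε.le
  have hPe0 : 0 ≤ (P : ℝ) ^ e := Real.rpow_nonneg (Nat.cast_nonneg _) e
  have hC0e : 0 ≤ max C 0 * (C₀ : ℝ) ^ e :=
    mul_nonneg (le_max_right _ _) (Real.rpow_nonneg (Nat.cast_nonneg _) e)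
  have hX23 : 0 ≤ (X : ℝ) ^ (2 / 3 : ℝ) := Real.rpow_nonneg hX0 _
  calc L ≤ C * (P : ℝ) ^ e := hL
    _ ≤ max C 0 * (P : ℝ) ^ e := mul_le_mul_of_nonneg_right (le_max_left _ _) hPe0
    _ ≤ max C 0 * (((C₀ : ℝ) * (X : ℝ) ^ 2) ^ e) := mul_le_mul_of_nonneg_left hPe (le_max_right _ _)
    _ = (max C 0 * (C₀ : ℝ) ^ e) * (X : ℝ) ^ (2 / 3 : ℝ) * (X : ℝ) ^ (ε : ℝ) := by rw [hsplit]; ring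
    _ ≤ (max C 0 * (C₀ : ℝ) ^ e) * (X : ℝ) ^ (2 / 3 : ℝ) * (R : ℝ) ^ (ε : ℝ) :=
        mul_le_mul_of_nonneg_left hXε (mul_nonneg hC0e hX23)
    _ = (max C 0 * (C₀ : ℝ) ^ e) * (R : ℝ) ^ (ε : ℝ) * (X : ℝ) ^ (2 / 3 : ℝ) := by ring

open Summit.ABC.ABC.Theorems Summit.ABC.ABC.Theorems.GoldenFromNFPencil in
/-- **L3 [M−]** `NFPencilBound → SideW`: port of the landed `goldenFromNFPencil_proof` with `k := 3`,
`α := ![0, 1, 1]`, `β := ![1, β₂, β₃]` over `QuadraticAlgebra ℚ 1 1` (`GoldenField.golden_fact / numberField /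
finrank_eq_two / ringOfIntegers_isPrincipalIdealRing`, `theta_mul_theta`, `lin_ne_zero` for `hprop`),
product `= w·Q` (L1′), norm bookkeeping `G_w·(G₊G₋) ≤ N(c)·(rad w · q)²`
(`absNorm_radical_span_intCast_le _ w` + the landed conjugate-pair block, verbatim), then L2 with `X := |rad w|·|rad Q| ≤ R`
(`natAbs_radical_prod`, `1 ≤ |rad u|`) and `X^{2/3} = q^{2/3}·(rad w)^{2/3}` (`Real.mul_rpow`). -/
theorem sideW_of_nfPencilBound :
    Summit.ABC.ABC.Theses.CuspFieldPencil.NFPencilBound → SideW := by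
  unfold Summit.ABC.ABC.Theses.CuspFieldPencil.NFPencilBound SideW
  intro hNF ε hε
  haveI hfact : Fact (∀ r : ℚ, r ^ 2 ≠ (1 : ℚ) + 1 * r) := ⟨GoldenField.golden_fact⟩
  haveI : NumberField (QuadraticAlgebra ℚ (1 : ℚ) 1) := GoldenField.numberField
  obtain ⟨θ, hθdef⟩ : ∃ θ : 𝓞 (QuadraticAlgebra ℚ (1 : ℚ) 1), θ = ⟨ω, GoldenField.isIntegral_omega⟩ := ⟨_, rfl⟩
  obtain ⟨β₂, h₂⟩ : ∃ x : 𝓞 (QuadraticAlgebra ℚ (1 : ℚ) 1), x = -3 - 5 * θ := ⟨_, rfl⟩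
  obtain ⟨β₃, h₃⟩ : ∃ x : 𝓞 (QuadraticAlgebra ℚ (1 : ℚ) 1), x = -8 + 5 * θ := ⟨_, rfl⟩
  obtain ⟨c, hc⟩ : ∃ x : 𝓞 (QuadraticAlgebra ℚ (1 : ℚ) 1), x = 5 * (2 * θ - 1) := ⟨_, rfl⟩
  have hθ : θ * θ = θ + 1 := by rw [hθdef]; exact theta_mul_theta
  have hβ23 : β₂ ≠ β₃ := by
    intro h
    have := lin_ne_zero 5 (-10) (by norm_num)
    apply this
    rw [← sub_eq_zero] at h
    rw [h₂, h₃, hθdef] at h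
    rw [← h]; push_cast; ring
  have hc0 : c ≠ 0 := by
    have := lin_ne_zero (-5) 10 (by norm_num)
    rw [hc, hθdef]; convert this using 1; push_cast; ring
  -- the three forms `w, u + β₂ w, u + β₃ w`
  let α : Fin 3 → 𝓞 (QuadraticAlgebra ℚ (1 : ℚ) 1) := ![0, 1, 1]
  let β : Fin 3 → 𝓞 (QuadraticAlgebra ℚ (1 : ℚ) 1) := ![1, β₂, β₃]
  have hprop : ∀ i j : Fin 3, i ≠ j → α i * β j ≠ α j * β i := by
    intro i j hij
    fin_cases i <;> fin_cases j <;>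
      simp [α, β, hβ23, hβ23.symm] at hij ⊢
  obtain ⟨C, hC⟩ := hNF (QuadraticAlgebra ℚ (1 : ℚ) 1) GoldenField.ringOfIntegers_isPrincipalIdealRing
    3 α β (by norm_num) hprop (ε / 2) (by positivity)
  refine ⟨max C 0 * (Ideal.absNorm (Ideal.span {c}) : ℝ) ^ (1 / (3 : ℝ) + ε / 2), ?_⟩
  intro u w hcop hne
  have hu : u ≠ 0 := fun h => hne (by rw [h]; ring)
  have hw : w ≠ 0 := fun h => hne (by rw [h]; ring)
  have hQ : u ^ 2 - 11 * u * w - w ^ 2 ≠ 0 := fun h => hne (by rw [h]; ring)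
  have hwQ : w * (u ^ 2 - 11 * u * w - w ^ 2) ≠ 0 := mul_ne_zero hw hQ
  have hprod : ∏ i, (α i * (u : 𝓞 (QuadraticAlgebra ℚ (1 : ℚ) 1)) + β i * (w : 𝓞 (QuadraticAlgebra ℚ (1 : ℚ) 1))) =
      ((w * (u ^ 2 - 11 * u * w - w ^ 2) : ℤ) : 𝓞 (QuadraticAlgebra ℚ (1 : ℚ) 1)) := by
    rw [prod_forms_three θ _ _ β₂ β₃ h₂ h₃ hθ]; push_cast; ring
  have hprod0 : ∏ i, (α i * (u : 𝓞 (QuadraticAlgebra ℚ (1 : ℚ) 1)) + β i * (w : 𝓞 (QuadraticAlgebra ℚ (1 : ℚ) 1))) ≠ 0 := by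
    rw [hprod]; exact_mod_cast hwQ
  have hmain := hC u w hcop hprod0
  -- `X := rad w · rad Q ≤ R = rad u · rad w · rad Q`
  have hru1 : 1 ≤ (radical u).natAbs := by
    exact_mod_cast Summit.ABC.ABC.Theorems.GoldenCuspShadowBaker.one_le_radR u
  have hXR : (radical w).natAbs * (radical (u ^ 2 - 11 * u * w - w ^ 2)).natAbs ≤
      (radical (u * w * (u ^ 2 - 11 * u * w - w ^ 2))).natAbs := by
    rw [natAbs_radical_prod hcop]
    calc (radical w).natAbs * (radical (u ^ 2 - 11 * u * w - w ^ 2)).natAbs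
        = 1 * ((radical w).natAbs * (radical (u ^ 2 - 11 * u * w - w ^ 2)).natAbs) := (one_mul _).symm
      _ ≤ (radical u).natAbs * ((radical w).natAbs * (radical (u ^ 2 - 11 * u * w - w ^ 2)).natAbs) :=
          Nat.mul_le_mul_right _ hru1
      _ = _ := by ring
  -- norm bookkeeping: `G_w · (G₊ G₋) ≤ rad(w)² · (N(5√5) · rad(Q)²)`
  have hG : ∏ i, Ideal.absNorm (Ideal.span {α i * (u : 𝓞 (QuadraticAlgebra ℚ (1 : ℚ) 1)) +
      β i * (w : 𝓞 (QuadraticAlgebra ℚ (1 : ℚ) 1))}).radical ≤ Ideal.absNorm (Ideal.span {c}) *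
      ((radical w).natAbs * (radical (u ^ 2 - 11 * u * w - w ^ 2)).natAbs) ^ 2 := by
    rw [Fin.prod_univ_three]
    simp only [α, β, Matrix.cons_val_zero, Matrix.cons_val_one, Matrix.cons_val_two, Matrix.head_cons,
      Matrix.tail_cons, one_mul, zero_mul, zero_add]
    have hfin : Module.finrank ℚ (QuadraticAlgebra ℚ (1 : ℚ) 1) = 2 := GoldenField.finrank_eq_two
    have hGw := absNorm_radical_span_intCast_le (QuadraticAlgebra ℚ (1 : ℚ) 1) w hw
    have hGQ := absNorm_radical_span_intCast_le (QuadraticAlgebra ℚ (1 : ℚ) 1) _ hQ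
    rw [hfin] at hGw hGQ
    -- the conjugate pair (verbatim from the landed `goldenFromNFPencil_proof`)
    obtain ⟨a, b, hab⟩ := hcop
    have hcmem : c ∈ Ideal.span {(u : 𝓞 (QuadraticAlgebra ℚ (1 : ℚ) 1)) + β₂ * w} ⊔
        Ideal.span {(u : 𝓞 (QuadraticAlgebra ℚ (1 : ℚ) 1)) + β₃ * w} := by
      have hab' : (a : 𝓞 (QuadraticAlgebra ℚ (1 : ℚ) 1)) * (u : 𝓞 (QuadraticAlgebra ℚ (1 : ℚ) 1)) +
          (b : 𝓞 (QuadraticAlgebra ℚ (1 : ℚ) 1)) * (w : 𝓞 (QuadraticAlgebra ℚ (1 : ℚ) 1)) = 1 := by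
        rw [← Int.cast_mul, ← Int.cast_mul, ← Int.cast_add, hab, Int.cast_one]
      have := sqrtFive_mem_sup θ (u : 𝓞 (QuadraticAlgebra ℚ (1 : ℚ) 1))
        (w : 𝓞 (QuadraticAlgebra ℚ (1 : ℚ) 1)) β₂ β₃ _ _ h₂ h₃ hab'
      simpa only [hc, one_mul] using this
    have hcN : Ideal.absNorm (Ideal.span {c}) ≠ 0 := by
      rw [Ne, Ideal.absNorm_eq_zero_iff, Ideal.span_singleton_eq_bot]; exact hc0
    have hpair := absNorm_radical_mul_absNorm_radical
      (Ideal.span {(u : 𝓞 (QuadraticAlgebra ℚ (1 : ℚ) 1)) + β₂ * w})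
      (Ideal.span {(u : 𝓞 (QuadraticAlgebra ℚ (1 : ℚ) 1)) + β₃ * w})
    have hsup := absNorm_sup_radical_le _ _ c hcmem hcN
    have hQK : Ideal.span {(u : 𝓞 (QuadraticAlgebra ℚ (1 : ℚ) 1)) + β₂ * w} *
        Ideal.span {(u : 𝓞 (QuadraticAlgebra ℚ (1 : ℚ) 1)) + β₃ * w} =
        Ideal.span {((u ^ 2 - 11 * u * w - w ^ 2 : ℤ) : 𝓞 (QuadraticAlgebra ℚ (1 : ℚ) 1))} := by
      rw [Ideal.span_singleton_mul_span_singleton]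
      congr 2
      have := formTwo_mul_formThree θ (u : 𝓞 (QuadraticAlgebra ℚ (1 : ℚ) 1)) (w : 𝓞 (QuadraticAlgebra ℚ (1 : ℚ) 1)) hθ
      rw [← h₂, ← h₃, one_mul] at this
      rw [this]; push_cast; ring
    rw [hQK] at hpair
    have h23 : Ideal.absNorm (Ideal.span {(u : 𝓞 (QuadraticAlgebra ℚ (1 : ℚ) 1)) + β₂ * w}).radical *
        Ideal.absNorm (Ideal.span {(u : 𝓞 (QuadraticAlgebra ℚ (1 : ℚ) 1)) + β₃ * w}).radical ≤
        Ideal.absNorm (Ideal.span {c}) * (radical (u ^ 2 - 11 * u * w - w ^ 2)).natAbs ^ 2 := by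
      rw [hpair]; exact Nat.mul_le_mul hsup hGQ
    calc _ = Ideal.absNorm (Ideal.span {(w : 𝓞 (QuadraticAlgebra ℚ (1 : ℚ) 1))}).radical *
          (Ideal.absNorm (Ideal.span {(u : 𝓞 (QuadraticAlgebra ℚ (1 : ℚ) 1)) + β₂ * w}).radical *
          Ideal.absNorm (Ideal.span {(u : 𝓞 (QuadraticAlgebra ℚ (1 : ℚ) 1)) + β₃ * w}).radical) := by
          ring
      _ ≤ (radical w).natAbs ^ 2 *
          (Ideal.absNorm (Ideal.span {c}) * (radical (u ^ 2 - 11 * u * w - w ^ 2)).natAbs ^ 2) :=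
          Nat.mul_le_mul hGw h23
      _ = _ := by ring
  -- real arithmetic: exponent `1/3 + ε/2` on `P ≤ N(c)·X²`, `X ≤ R`
  have hlhs : Real.log (((max |u| |w| : ℤ)) : ℝ) = Real.log (max |(u : ℝ)| |(w : ℝ)|) := by
    push_cast; rfl
  have hexp : (1 / ((3 : ℕ) : ℝ) + ε / 2) = (1 / (3 : ℝ) + ε / 2) := by norm_num
  rw [hexp] at hmain
  have key := real_step_twoThirds hε hmain hG hXR
  have hsplitX : ((((radical w).natAbs * (radical (u ^ 2 - 11 * u * w - w ^ 2)).natAbs : ℕ)) : ℝ) ^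
      (2 / 3 : ℝ) =
      (((radical (u ^ 2 - 11 * u * w - w ^ 2)).natAbs : ℕ) : ℝ) ^ (2 / 3 : ℝ) *
        (((radical w).natAbs : ℕ) : ℝ) ^ (2 / 3 : ℝ) := by
    push_cast
    rw [Real.mul_rpow (Nat.cast_nonneg _) (Nat.cast_nonneg _), mul_comm]
  rw [← hlhs, ← hsplitX]
  exact key

/-- **L4 [S]** the cusp swap `(u, w) ↦ (w, −u)`: `SideW → SideU` (`u·w·Q` is literally invariant (`ring`),
`Q(w,−u) = −Q(u,w)` and `UniqueFactorizationDomain.radical_neg`, `abs_neg`, `max_comm`;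
pattern: landed `GoldenCuspShadowBaker.routeW_of_routeU`). -/
theorem sideU_of_sideW : SideW → SideU := by
  intro hW ε hε
  obtain ⟨κ, hκ⟩ := hW ε hε
  refine ⟨κ, fun u w h h0 => ?_⟩
  have hprod : w * -u * (w ^ 2 - 11 * w * -u - (-u) ^ 2) = u * w * (u ^ 2 - 11 * u * w - w ^ 2) := by ring
  have hQ : w ^ 2 - 11 * w * -u - (-u) ^ 2 = -(u ^ 2 - 11 * u * w - w ^ 2) := by ring
  have h0' : w * -u * (w ^ 2 - 11 * w * -u - (-u) ^ 2) ≠ 0 := by rw [hprod]; exact h0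
  have key := hκ w (-u) h.symm.neg_right h0'
  rw [hprod, hQ] at key
  simp only [UniqueFactorizationDomain.radical_neg] at key
  have hmax : max |((w : ℤ) : ℝ)| |((-u : ℤ) : ℝ)| = max |((u : ℤ) : ℝ)| |((w : ℤ) : ℝ)| := by
    rw [Int.cast_neg, abs_neg, max_comm]
  rw [hmax] at key
  exact key

/-- **L5 [S]** min-assembly: `SideW → SideU → Sig` (`κ := max (max κ_W κ_U) 0`; `min_choice` on the radicals,
`Real.rpow_le_rpow` is not even needed: rewrite `min` to the chosen side; pattern: landed `cuspMin_of_routes`). -/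
theorem sig_of_sides : SideW → SideU → Sig := by
  intro hW hU ε hε
  obtain ⟨κ₁, h₁⟩ := hU ε hε
  obtain ⟨κ₂, h₂⟩ := hW ε hε
  refine ⟨max (max κ₁ κ₂) 0, fun u w h h0 => ?_⟩
  have hR : 0 ≤ (((radical (u * w * (u ^ 2 - 11 * u * w - w ^ 2))).natAbs : ℕ) : ℝ) ^ (ε : ℝ) :=
    Real.rpow_nonneg (Nat.cast_nonneg _) _
  have hq : 0 ≤ (((radical (u ^ 2 - 11 * u * w - w ^ 2)).natAbs : ℕ) : ℝ) ^ (2 / 3 : ℝ) :=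
    Real.rpow_nonneg (Nat.cast_nonneg _) _
  have hk₁ : κ₁ ≤ max (max κ₁ κ₂) 0 := (le_max_left _ _).trans (le_max_left _ _)
  have hk₂ : κ₂ ≤ max (max κ₁ κ₂) 0 := (le_max_right _ _).trans (le_max_left _ _)
  rcases min_choice ((((radical u).natAbs : ℕ) : ℝ)) ((((radical w).natAbs : ℕ) : ℝ)) with hmin | hmin <;>
    rw [hmin]
  · exact (h₁ u w h h0).trans
      (mul_le_mul_of_nonneg_right (mul_le_mul_of_nonneg_right hk₁ hR)
        (mul_nonneg hq (Real.rpow_nonneg (Nat.cast_nonneg _) _)))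
  · exact (h₂ u w h h0).trans
      (mul_le_mul_of_nonneg_right (mul_le_mul_of_nonneg_right hk₂ hR)
        (mul_nonneg hq (Real.rpow_nonneg (Nat.cast_nonneg _) _)))

/-! ## §2 ROAD R2 — `QSideRadSq → Sig` with the landed `cuspMin` (regime split `min(m, q²) ≤ q^{2/3} m^{2/3}`) -/

/-- **R1 [XS]** `min(m, q²) ≤ q^{2/3}·m^{2/3}` for `m, q ≥ 0` (case `m ≤ q²`: `m = m^{2/3}m^{1/3}`; else `q² = q^{2/3}(q²)^{2/3}`). -/
theorem min_sq_le_rpow_mul_rpow {m q : ℝ} (hm : 0 ≤ m) (hq : 0 ≤ q) :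
    min m (q ^ 2) ≤ q ^ (2 / 3 : ℝ) * m ^ (2 / 3 : ℝ) := by
  have hq2 : (0 : ℝ) ≤ q ^ 2 := by positivity
  have split : ∀ a : ℝ, 0 ≤ a → a = a ^ (1 / 3 : ℝ) * a ^ (2 / 3 : ℝ) := by
    intro a ha
    rw [← Real.rpow_add' ha (by norm_num : (1 / 3 : ℝ) + 2 / 3 ≠ 0)]
    norm_num
  have e1 : (q ^ 2) ^ (1 / 3 : ℝ) = q ^ (2 / 3 : ℝ) := by
    rw [← Real.rpow_natCast, ← Real.rpow_mul hq]; norm_num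
  rcases le_total m (q ^ 2) with h | h
  · rw [min_eq_left h]
    calc m = m ^ (1 / 3 : ℝ) * m ^ (2 / 3 : ℝ) := split m hm
      _ ≤ (q ^ 2) ^ (1 / 3 : ℝ) * m ^ (2 / 3 : ℝ) := by gcongr
      _ = q ^ (2 / 3 : ℝ) * m ^ (2 / 3 : ℝ) := by rw [e1]
  · rw [min_eq_right h]
    calc q ^ 2 = (q ^ 2) ^ (1 / 3 : ℝ) * (q ^ 2) ^ (2 / 3 : ℝ) := split (q ^ 2) hq2
      _ ≤ (q ^ 2) ^ (1 / 3 : ℝ) * m ^ (2 / 3 : ℝ) := by gcongr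
      _ = q ^ (2 / 3 : ℝ) * m ^ (2 / 3 : ℝ) := by rw [e1]

/-- **R2 [S]** `CuspMin → QSideRadSq → Sig` (`κ := max (max κ₁ κ₂) 0`, bound by `κ R^ε · min(m, q²)`, then R1). -/
theorem sig_of_cuspMin_qSideRadSq : CuspMin → QSideRadSq → Sig := by
  intro hC hQ ε hε
  obtain ⟨κ₁, h₁⟩ := hC ε hε
  obtain ⟨κ₂, h₂⟩ := hQ ε hε
  refine ⟨max (max κ₁ κ₂) 0, fun u w h h0 => ?_⟩
  set R : ℝ := (((radical (u * w * (u ^ 2 - 11 * u * w - w ^ 2))).natAbs : ℕ) : ℝ) with hRdef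
  set m : ℝ := min ((((radical u).natAbs : ℕ) : ℝ)) ((((radical w).natAbs : ℕ) : ℝ)) with hmdef
  set q : ℝ := (((radical (u ^ 2 - 11 * u * w - w ^ 2)).natAbs : ℕ) : ℝ) with hqdef
  have hR : 0 ≤ R ^ (ε : ℝ) := Real.rpow_nonneg (Nat.cast_nonneg _) _
  have hK0 : 0 ≤ max (max κ₁ κ₂) 0 := le_max_right _ _
  have hk₁ : κ₁ ≤ max (max κ₁ κ₂) 0 := (le_max_left _ _).trans (le_max_left _ _)
  have hk₂ : κ₂ ≤ max (max κ₁ κ₂) 0 := (le_max_right _ _).trans (le_max_left _ _)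
  have hm0 : 0 ≤ m := le_min (Nat.cast_nonneg _) (Nat.cast_nonneg _)
  have hq0 : 0 ≤ q := Nat.cast_nonneg _
  have A : Real.log (max |(u : ℝ)| |(w : ℝ)|) ≤ max (max κ₁ κ₂) 0 * R ^ (ε : ℝ) * m :=
    (h₁ u w h h0).trans (mul_le_mul_of_nonneg_right (mul_le_mul_of_nonneg_right hk₁ hR) hm0)
  have B : Real.log (max |(u : ℝ)| |(w : ℝ)|) ≤ max (max κ₁ κ₂) 0 * R ^ (ε : ℝ) * q ^ 2 :=
    (h₂ u w h h0).trans (mul_le_mul_of_nonneg_right (mul_le_mul_of_nonneg_right hk₂ hR) (by positivity))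
  have C : Real.log (max |(u : ℝ)| |(w : ℝ)|) ≤ max (max κ₁ κ₂) 0 * R ^ (ε : ℝ) * min m (q ^ 2) := by
    rcases min_choice m (q ^ 2) with hmin | hmin <;> rw [hmin]
    · exact A
    · exact B
  exact C.trans (mul_le_mul_of_nonneg_left (min_sq_le_rpow_mul_rpow hm0 hq0) (mul_nonneg hK0 hR))

/-- **P0 [XS]** weighted-mean bound `min x y ≤ x^α y^β` (`α + β = 1`, `α, β ≥ 0`). -/
theorem min_le_rpow_mul_rpow {x y α β : ℝ} (hx : 0 ≤ x) (hy : 0 ≤ y) (hα : 0 ≤ α) (hβ : 0 ≤ β)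
    (hαβ : α + β = 1) : min x y ≤ x ^ α * y ^ β := by
  have split : ∀ a : ℝ, 0 ≤ a → a = a ^ α * a ^ β := by
    intro a ha
    rw [← Real.rpow_add' ha (by rw [hαβ]; norm_num), hαβ, Real.rpow_one]
  rcases le_total x y with h | h
  · rw [min_eq_left h]
    calc x = x ^ α * x ^ β := split x hx
      _ ≤ x ^ α * y ^ β := by gcongr
  · rw [min_eq_right h]
    calc y = y ^ α * y ^ β := split y hy
      _ ≤ x ^ α * y ^ β := by gcongr

/-! ## §3 Payoffs (what the stub buys although the crux is closed: class exponent 1/2 → 2/5 → 1/3) -/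

/-- **P1 [S+]** `CuspMin → Sig → GoldenTwoFifths`: with `R = rad u · rad w · q` (`GoldenFromNFPencil.natAbs_radical_prod`)
and `m² ≤ rad u · rad w`: if `m ≤ R^{2/5}` use `CuspMin`; else `q ≤ R/m² < R^{1/5}` and
`q^{2/3}m^{2/3} = (m^{2/3}q^{1/3})·q^{1/3} ≤ R^{1/3}·R^{1/15} = R^{2/5}`. -/
theorem goldenTwoFifths_of_sig : CuspMin → Sig → GoldenTwoFifths := by
  intro hC hS ε hε
  obtain ⟨κ₁, h₁⟩ := hC ε hε
  obtain ⟨κ₂, h₂⟩ := hS ε hε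
  refine ⟨max (max κ₁ κ₂) 0, fun u w h h0 => ?_⟩
  set a : ℝ := (((radical u).natAbs : ℕ) : ℝ) with hadef
  set b : ℝ := (((radical w).natAbs : ℕ) : ℝ) with hbdef
  set q : ℝ := (((radical (u ^ 2 - 11 * u * w - w ^ 2)).natAbs : ℕ) : ℝ) with hqdef
  set R : ℝ := (((radical (u * w * (u ^ 2 - 11 * u * w - w ^ 2))).natAbs : ℕ) : ℝ) with hRdef
  set m : ℝ := min a b with hmdef
  set K : ℝ := max (max κ₁ κ₂) 0 with hKdef
  have ha0 : 0 ≤ a := Nat.cast_nonneg _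
  have hb0 : 0 ≤ b := Nat.cast_nonneg _
  have hq0 : 0 ≤ q := Nat.cast_nonneg _
  have hR1 : 1 ≤ R := Summit.ABC.ABC.Theorems.GoldenCuspShadowBaker.one_le_radR _
  have hR0 : 0 < R := by linarith
  have hm0 : 0 ≤ m := le_min ha0 hb0
  have hRabq : R = a * b * q := by
    rw [hRdef, hadef, hbdef, hqdef, Summit.ABC.ABC.Theorems.GoldenFromNFPencil.natAbs_radical_prod h]
    push_cast; ring
  have hK0 : 0 ≤ K := le_max_right _ _
  have hk₁ : κ₁ ≤ K := (le_max_left _ _).trans (le_max_left _ _)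
  have hk₂ : κ₂ ≤ K := (le_max_right _ _).trans (le_max_left _ _)
  have hRε : 0 ≤ R ^ (ε : ℝ) := Real.rpow_nonneg hR0.le _
  set y : ℝ := q ^ (2 / 3 : ℝ) * m ^ (2 / 3 : ℝ) with hydef
  have hy0 : 0 ≤ y := mul_nonneg (Real.rpow_nonneg hq0 _) (Real.rpow_nonneg hm0 _)
  have A : Real.log (max |(u : ℝ)| |(w : ℝ)|) ≤ K * R ^ (ε : ℝ) * m :=
    (h₁ u w h h0).trans (mul_le_mul_of_nonneg_right (mul_le_mul_of_nonneg_right hk₁ hRε) hm0)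
  have B : Real.log (max |(u : ℝ)| |(w : ℝ)|) ≤ K * R ^ (ε : ℝ) * y :=
    (h₂ u w h h0).trans (mul_le_mul_of_nonneg_right (mul_le_mul_of_nonneg_right hk₂ hRε) hy0)
  have C : Real.log (max |(u : ℝ)| |(w : ℝ)|) ≤ K * R ^ (ε : ℝ) * min m y := by
    rcases min_choice m y with hmin | hmin <;> rw [hmin]
    · exact A
    · exact B
  have hy35 : y ^ (3 / 5 : ℝ) = q ^ (2 / 5 : ℝ) * m ^ (2 / 5 : ℝ) := by
    rw [hydef, Real.mul_rpow (Real.rpow_nonneg hq0 _) (Real.rpow_nonneg hm0 _),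
      ← Real.rpow_mul hq0, ← Real.rpow_mul hm0]
    norm_num
  have hm2q : m ^ 2 * q ≤ R := by
    rw [hRabq]
    have : m ^ 2 ≤ a * b := by
      rw [sq]; exact mul_le_mul (min_le_left _ _) (min_le_right _ _) hm0 ha0
    exact mul_le_mul_of_nonneg_right this hq0
  have hstep : min m y ≤ R ^ (2 / 5 : ℝ) := by
    calc min m y ≤ m ^ (2 / 5 : ℝ) * y ^ (3 / 5 : ℝ) :=
          min_le_rpow_mul_rpow hm0 hy0 (by norm_num) (by norm_num) (by norm_num)
      _ = (m ^ (2 / 5 : ℝ) * m ^ (2 / 5 : ℝ)) * q ^ (2 / 5 : ℝ) := by rw [hy35]; ring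
      _ = m ^ (4 / 5 : ℝ) * q ^ (2 / 5 : ℝ) := by
          rw [← Real.rpow_add' hm0 (by norm_num : (2 / 5 : ℝ) + 2 / 5 ≠ 0)]; norm_num
      _ = (m ^ 2 * q) ^ (2 / 5 : ℝ) := by
          rw [Real.mul_rpow (pow_nonneg hm0 2) hq0, show m ^ 2 = m ^ (2 : ℝ) by norm_cast,
            ← Real.rpow_mul hm0]
          norm_num
      _ ≤ R ^ (2 / 5 : ℝ) := Real.rpow_le_rpow (by positivity) hm2q (by norm_num)
  have hfinal : K * R ^ (ε : ℝ) * min m y ≤ K * R ^ (2 / 5 + ε : ℝ) := by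
    calc K * R ^ (ε : ℝ) * min m y ≤ K * R ^ (ε : ℝ) * R ^ (2 / 5 : ℝ) :=
          mul_le_mul_of_nonneg_left hstep (mul_nonneg hK0 hRε)
      _ = K * R ^ (2 / 5 + ε : ℝ) := by
          rw [mul_assoc, ← Real.rpow_add hR0, add_comm]
  exact C.trans hfinal

/-- **P2 [S]** `CuspMin → QSideRad → GoldenThird` (`min(m, q) ≤ (m²q)^{1/3} ≤ R^{1/3}`; k2-g6 `third_of_uwHalf_qSideRad`). -/
theorem goldenThird_of_qSideRad : CuspMin → QSideRad → GoldenThird := by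
  intro hC hQ ε hε
  obtain ⟨κ₁, h₁⟩ := hC ε hε
  obtain ⟨κ₂, h₂⟩ := hQ ε hε
  refine ⟨max (max κ₁ κ₂) 0, fun u w h h0 => ?_⟩
  set a : ℝ := (((radical u).natAbs : ℕ) : ℝ) with hadef
  set b : ℝ := (((radical w).natAbs : ℕ) : ℝ) with hbdef
  set q : ℝ := (((radical (u ^ 2 - 11 * u * w - w ^ 2)).natAbs : ℕ) : ℝ) with hqdef
  set R : ℝ := (((radical (u * w * (u ^ 2 - 11 * u * w - w ^ 2))).natAbs : ℕ) : ℝ) with hRdef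
  set m : ℝ := min a b with hmdef
  set K : ℝ := max (max κ₁ κ₂) 0 with hKdef
  have ha0 : 0 ≤ a := Nat.cast_nonneg _
  have hb0 : 0 ≤ b := Nat.cast_nonneg _
  have hq0 : 0 ≤ q := Nat.cast_nonneg _
  have hR1 : 1 ≤ R := Summit.ABC.ABC.Theorems.GoldenCuspShadowBaker.one_le_radR _
  have hR0 : 0 < R := by linarith
  have hm0 : 0 ≤ m := le_min ha0 hb0
  have hRabq : R = a * b * q := by
    rw [hRdef, hadef, hbdef, hqdef, Summit.ABC.ABC.Theorems.GoldenFromNFPencil.natAbs_radical_prod h]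
    push_cast; ring
  have hK0 : 0 ≤ K := le_max_right _ _
  have hk₁ : κ₁ ≤ K := (le_max_left _ _).trans (le_max_left _ _)
  have hk₂ : κ₂ ≤ K := (le_max_right _ _).trans (le_max_left _ _)
  have hRε : 0 ≤ R ^ (ε : ℝ) := Real.rpow_nonneg hR0.le _
  have A : Real.log (max |(u : ℝ)| |(w : ℝ)|) ≤ K * R ^ (ε : ℝ) * m :=
    (h₁ u w h h0).trans (mul_le_mul_of_nonneg_right (mul_le_mul_of_nonneg_right hk₁ hRε) hm0)
  have B : Real.log (max |(u : ℝ)| |(w : ℝ)|) ≤ K * R ^ (ε : ℝ) * q :=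
    (h₂ u w h h0).trans (mul_le_mul_of_nonneg_right (mul_le_mul_of_nonneg_right hk₂ hRε) hq0)
  have C : Real.log (max |(u : ℝ)| |(w : ℝ)|) ≤ K * R ^ (ε : ℝ) * min m q := by
    rcases min_choice m q with hmin | hmin <;> rw [hmin]
    · exact A
    · exact B
  have hm2q : m ^ 2 * q ≤ R := by
    rw [hRabq]
    have : m ^ 2 ≤ a * b := by
      rw [sq]; exact mul_le_mul (min_le_left _ _) (min_le_right _ _) hm0 ha0
    exact mul_le_mul_of_nonneg_right this hq0
  have hstep : min m q ≤ R ^ (1 / 3 : ℝ) := by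
    calc min m q ≤ m ^ (2 / 3 : ℝ) * q ^ (1 / 3 : ℝ) :=
          min_le_rpow_mul_rpow hm0 hq0 (by norm_num) (by norm_num) (by norm_num)
      _ = (m ^ 2 * q) ^ (1 / 3 : ℝ) := by
          rw [Real.mul_rpow (pow_nonneg hm0 2) hq0, show m ^ 2 = m ^ (2 : ℝ) by norm_cast,
            ← Real.rpow_mul hm0]
          norm_num
      _ ≤ R ^ (1 / 3 : ℝ) := Real.rpow_le_rpow (by positivity) hm2q (by norm_num)
  have hfinal : K * R ^ (ε : ℝ) * min m q ≤ K * R ^ (1 / 3 + ε : ℝ) := by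
    calc K * R ^ (ε : ℝ) * min m q ≤ K * R ^ (ε : ℝ) * R ^ (1 / 3 : ℝ) :=
          mul_le_mul_of_nonneg_left hstep (mul_nonneg hK0 hRε)
      _ = K * R ^ (1 / 3 + ε : ℝ) := by
          rw [mul_assoc, ← Real.rpow_add hR0, add_comm]
  exact C.trans hfinal

/-! ## §4 Assembly (sorry-free compositions; inputs BY NAME from the tree) -/

/-- `CuspMin` is the landed theorem. -/
theorem cuspMin_holds : CuspMin :=
  Summit.ABC.ABC.Theorems.GoldenCuspShadowBaker.cuspMinRadBound_holds

/-- ROAD R1: the stub from the route's parametric item `NFPencilBound` (unconditional implication). -/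
theorem sig_of_nfPencilBound (h : Summit.ABC.ABC.Theses.CuspFieldPencil.NFPencilBound) : Sig :=
  sig_of_sides (sideW_of_nfPencilBound h) (sideU_of_sideW (sideW_of_nfPencilBound h))

/-- ROAD R1 ∘ landed `nfPencilBound_of_scoones2021`: the stub PROVED-MOD-FACT {Scoones 2023 Thm 3}. -/
theorem stub_conjugateCuspTriple_of_scoones2021
    (hS : scoones2021_abcNumberField_classNumberOne) : Sig :=
  sig_of_nfPencilBound (Summit.ABC.ABC.Theorems.nfPencilBound_of_scoones2021 hS)

/-- ROAD R2: the stub from the crude `K`-datum alone (the `cuspMin` half is in the tree). -/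
theorem sig_of_qSideRadSq (h : QSideRadSq) : Sig :=
  sig_of_cuspMin_qSideRadSq cuspMin_holds h

/-- Payoff: class exponent `2/5` modulo Scoones; `1/3` from `QSideRad`. -/
theorem goldenTwoFifths_of_scoones2021 (hS : scoones2021_abcNumberField_classNumberOne) :
    GoldenTwoFifths :=
  goldenTwoFifths_of_sig cuspMin_holds (stub_conjugateCuspTriple_of_scoones2021 hS)

theorem goldenThird_of_qSideRad' (h : QSideRad) : GoldenThird :=
  goldenThird_of_qSideRad cuspMin_holds h

/-- Sanity: `Sig` is literally the registered signature (the verbatim header a prover must use). -/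
example (h : Sig) : ∀ ε : ℝ, 0 < ε → ∃ κ : ℝ, ∀ u w : ℤ, IsCoprime u w → u * w * (u ^ 2 - 11 * u * w - w ^ 2) ≠ 0 → Real.log (max (|(u : ℝ)|) (|(w : ℝ)|)) ≤ κ * (((UniqueFactorizationMonoid.radical (u * w * (u ^ 2 - 11 * u * w - w ^ 2))).natAbs : ℕ) : ℝ) ^ (ε : ℝ) * ((((UniqueFactorizationMonoid.radical (u ^ 2 - 11 * u * w - w ^ 2)).natAbs : ℕ) : ℝ) ^ (2 / 3 : ℝ) * (min (((UniqueFactorizationMonoid.radical u).natAbs : ℕ) : ℝ) (((UniqueFactorizationMonoid.radical w).natAbs : ℕ) : ℝ)) ^ (2 / 3 : ℝ)) :=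
  h

end Summit.ABC.ABC.Cruxes.GoldenCuspShadow.SideaK2G8

end
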